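import Literature.MathematicalPhysics.QuantumFieldTheory.Balaban1983to89.Node00.N24GlueStage10C
import Literature.MathematicalPhysics.QuantumFieldTheory.Balaban1983to89.B12NodeKnitRecord10
import Literature.MathematicalPhysics.QuantumFieldTheory.Balaban1983to89.B16NodeKnitRecord10
import Literature.MathematicalPhysics.QuantumFieldTheory.Balaban1983to89.Node00.Record10Carriers

/-!
# NODE N24 · (B2) AT NODE 00's STAGE-10 RECORD `IsRecordOfRecord₁₀C`, EVERY CHILD ENTERED AT THE RECORD'S OWN PARAMETERS BY NAME — the children's
# Stage-10 knits (seat dag-n09-a's `B12NodeKnitRecord10`, seat dag-n13-a's `B16NodeKnitRecord10`) replace module 18's by-name binders `h09` ∕ `h11` ∕ `hR`+`hcor3`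

TRACK A (YM-PLAN §2d, node N24 of 28 = binder B2 `hB : B16.EndStatementBPrinted D.C`), seat `pub-ymgap-dag-n24-a` (-a KNIT-BY-NAME; trigger (t2′) of HANDOFF v1.4, dag-lead
word «WANTED inside the wall», pub-ymgap INBOX l.11409).  NINETEENTH N24 module, NEW importing (modules 1–18 untouched).  THEOREMS ONLY, def-free, sorry-free, standard axioms.

WHY.  Module 18 (`N24GlueStage10C.N24_at_record₁₀C_knit_pinned`) displayed N09 and N11 as by-name binders `∀ P, Dag.B12_main ∕ Dag.B14_main (leavesP w P)` and N13
world-level (`hR` + `hcor3`), because the children's Stage-10 knits had `Record10` ACCEPT as their own trigger.  They have landed, in the letters of module 16's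
Stage-9 forms with ₉ ↦ ₁₀:
* **N09** = `B12NodeKnitRecord10.b12_main_at_record₁₀C_of_leaf` — the ₁₀ twin of `B12NodeKnitRecord9.b12_main_at_record₉C_of_leaf` WITH THE COMPOSITION BINDER `hcomp`
  GONE (the record's proviso `contT` feeds `B12NodeKnitContinuousTransport`): four θ-keyed binders over the presenting parameters, under `w.γ ≤ θ.γ` — the B12-group
  pin slot `slot12` (Lemma 4 (3.53) over the residual B12 group), `h11dom` ([Balaban1985Variational] (1.1) existence + orbit-uniqueness on `domAltOfRecord`), `hres`
  (`HRestrict` on `domAltOfRecord`), `huniq` (orbit-uniqueness along the averaging iterates of the minimiser);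
* **N11 ∧ N13** = `B16NodeKnitRecord10.nodes_N11_N13_of_isRecordOfRecord₁₀C` — the junction slots (S0) `smallCouplings → SLaw₁₀ θ P 0`, (S1ᵀ) «N11's antecedents →
  ∀ k < K, SLaw₁₀ k → TLaw₁₀ k» ([Balaban1988Convergent] Theorem p. 245), (R₁₀) «∀ k < K, TLaw₁₀ k → SLaw₁₀ (k+1)» ([Balaban1989LargeFieldII] Thm 1; = the record's
  𝐑-leaf, module 18's `N24_forall_pinned_rOperation_iff₁₀C`), (UV₁₀) «interval on `]0, w.γ]` → ∀ k ≤ K, SLaw₁₀ k → (0.1) POINTWISE on `densOfRecord₁₀ θ P k` with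
  `χ = chiFixed7 θ.ν`, `A^η = wilsonBGOfRecord`, `g_k = gOfRecord₁₀`, `e₋ = w.em`, `e₊ = w.ep`» — all AT THE STAGE-10 OBJECTS OF RECORD (FORMAT FACE, director RIDER
  №38: `SLaw₁₀ ∕ TLaw₁₀` read the residual `S218 ∕ ScorrLaw`; content over `Sect2FormOfRecord` ∕ `Record11`).
So this file's headline `N24_at_record₁₀C_knit_all_pinned` is module 16's `N24_at_record₉C_knit_all_pinned` RE-KEYED ₉ ↦ ₁₀ BY NAME, and its hypothesis list is
WHICH CHILD BLOCKS AT ₁₀C WITH NO PURE NODE BINDER: six residual-carrier sockets ∕ slots (X-[B8] ∕ [B10] ∕ B13, Y, Z, W — `Record10Carriers` pins them), N09's four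
Stage-10 inputs, the four N11∕N13 slots, the β-box (or the merged β over the continuous-version transport, §2).

WHAT THIS FILE PROVES.
§1 **`N24_at_record₁₀C_knit_all_pinned`** (every child at θ₁₀ by name; module 18's engine `N24_at_record₁₀C` fed by module 18 §0's socket theorems, n09-a's N09 and n13-a's
   junction); `N24_at_record₁₀C_knit_N09_N11_N13` (the three Stage-10-native children by name, the six carrier children as by-name binders).
§2 `N24_at_record₁₀C_knit_all_of_betaMerged_pinned` — β READ AT THE MERGED β OVER `mergedTermFamilyMatT (TcOfRecord) (chiFixed7 θ.ν)` along `]0, w.γ]^{k+1}` (module 18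
   §2's iffs; RIDER №6 EXECUTED: continuous-version transport, point values determined under `contT`, `Record10.exists_betaVersion_of_isRecordOfRecord₁₀C`).
§3 `N24_stabilityB_itemShape₁₀C_knit_all_pinned` — the item body (stmt-QuantumFields-19183, rev 0) in its literal shape at general `N`.
§4 AT THE TOP OF THE STAGE-10 CARRIER CHAIN `IsRecordOfRecord₁₀CB10YZ → ₁₀C` (seat node00-def g30's `Record10Carriers`, same `(D, w)`): `N24_at_record₁₀CB10YZ_knit_all_pinned`
   (the one-line transfer of §1 through `isRecordOfRecord₁₀C_of_isRecordOfRecord₁₀CB10YZ`) and **`N24_at_record₁₀CB10YZ_knit_all_carriers_pinned`** — the three PINNED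
   children at their statements of record on the chain (module 17's recipe at Stage 10): N08 ← the printed slot `PrintedUV3V N L` at the world's block size
   (`b10_main_iff_of_isRecordOfRecord₁₀CB10YZ`), N06 ∧ N07 ← «for every presenting `(θ, h, M⋆, ops, ζ)`: def-Y's leaf `B9LeafX (Y9OfRecord N θ₃ M⋆ ops)` ∧ the [B11] leaf
   `B11Leaf (Z11OfRecord F N ζ)`» (`b9_b11_main_of_isRecordOfRecord₁₀CB10YZ_of_slots`; both quantify over HIDDEN residual layers — junk-closable, `B9PinCarriersNonVacuity.exists_ops_b9LeafX`,
   `CarriersZ.exists_residZ_not_b11Leaf` — hence NOT bookable in ∀-form; location-positive, strength-neutral); the X-[B8] ∕ B13 ∕ W sockets, N09, N11 ∧ N13 as in §1.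

VACUITY ∕ A1 (LINE №45 (3), RIDER №7): K0 at Stage 10 is OWED at `N ≥ 2`; every theorem below is a per-record implication; a ∀-form over ₁₀C ∕ ₁₀CB10YZ is NOT-A-DISCHARGE.
HONEST FRAMING: kernel bookkeeping BY NAME; nothing of Bałaban's asserted; every slot DISPLAYED; N24 COMPOSITE — no discharge, no count; one finite T⁴ at fixed ε; NOT continuum ∕ ℝ⁴ ∕ OS ∕ mass gap ∕ Clay.
-/

noncomputable section

open scoped Matrix.Norms.L2Operator

namespace Literature.MathematicalPhysics.QuantumFieldTheory.Balaban1983to89.Node00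

open DagBinding T4Continuum T4DatumAssembly FlowStepRuns AveragingRT
open FlowStep (box_mono)

variable {F : T4Family} {N : ℕ} [NeZero N] {D : FiniteEpsData F (SU N)} {w : WorldP}

/-! ## §1. (B2) at the Stage-10 record, every child at θ₁₀ by name -/

/-- **N24 · (B2) AT THE STAGE-10 RECORD, EVERY PAPER CHILD ENTERED AT THE RECORD'S OWN PARAMETERS BY NAME.**  N01 N02 N03 N04 theorems (inside module 18's engine);
N05 N06 N07 N12 θ-keyed pinned carrier sockets on the residual groups X ∕ Y ∕ Z ∕ W over `θ.toStage5₁₀` (module 18 §0); N08 the leaf-system slot; N10 the B13 socket; **N09** seat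
dag-n09-a's `B12NodeKnitRecord10.b12_main_at_record₁₀C_of_leaf` (`slot12`, `h11dom`, `hres`, `huniq` — no composition binder); **N11 ∧ N13** seat dag-n13-a's junction
`B16NodeKnitRecord10.nodes_N11_N13_of_isRecordOfRecord₁₀C` (slots (S0) (S1ᵀ) (R₁₀) (UV₁₀) at `SLaw₁₀ ∕ TLaw₁₀ ∕ densOfRecord₁₀ ∕ gOfRecord₁₀ ∕ chiFixed7`); β-box on `D.βfun`
over `]0, γ₀]`.  THE HYPOTHESIS LIST IS «WHICH CHILD BLOCKS AT ₁₀C» IN KERNEL FORM — no pure node binder. [cite: Balaban1989LargeFieldII, Thm 1 p.355, (0.1) pp.355–356, p.387, p.391; Balaban1988Convergent, Thm 1 p.262, Theorem p.245, p.244, (2.18) p.257; Balaban1987RG1, Thm 1 p.259, Thm 3 p.264, Lemma 4 (3.53) p.280, (1.1)–(1.3) p.260, (1.22) p.264; Balaban1985Variational, Thm 1 (8)–(10) p.279; Balaban1985RegularSpaces, Thms 2, 4, 8 pp.83–101; Balaban1985BackgroundPropagators, Thms 3.1–3.15 pp.397–432; Balaban1985UV3, Thm 1 p.257 + Thm 2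 p.272; Balaban1988RG2Cluster, Lemmas 1–3 pp.9, 11, 20; Balaban1989LargeFieldI, Prop. 1 p.194; Balaban1984PropagatorsII, pp.234–249 (bookkeeping over the Stage-10 record)] -/
theorem N24_at_record₁₀C_knit_all_pinned (h : IsRecordOfRecord₁₀C F N D w) {γ₀ : ℝ} (hγ₀ : w.γ ≤ γ₀)
    (slots₀₅ : ∀ (θ : Stage9Params F N) (hP : θ.Provisos₁₀), θ.Admissible → D = datumOfRecord₁₀ F N θ hP →
      (∀ P, w.up P = upOfRecord₅C F N (θ.toStage5₁₀ F N) P) → ∀ P : B12.RunParams,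
        B8LeafR (θ.res.X P).d8 (θ.res.X P).L8 (θ.res.X P).C₂ (θ.res.X P).B₁' (θ.res.X P).B₀' (θ.res.X P).B₁ (θ.res.X P).B₂ (θ.res.X P).c₁
          (θ.res.X P).inp8 (θ.res.X P).B₀β (θ.res.X P).loc8 (θ.res.X P).fam8R (θ.res.X P).lan8 (θ.res.X P).cub8 (θ.res.X P).toAxial8)
    (slots₀₆ : ∀ (θ : Stage9Params F N) (hP : θ.Provisos₁₀), θ.Admissible → D = datumOfRecord₁₀ F N θ hP →
      (∀ P, w.up P = upOfRecord₅C F N (θ.toStage5₁₀ F N) P) → ∀ P : B12.RunParams, B9LeafX (θ.res.Y P))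
    (slots₀₇ : ∀ (θ : Stage9Params F N) (hP : θ.Provisos₁₀), θ.Admissible → D = datumOfRecord₁₀ F N θ hP →
      (∀ P, w.up P = upOfRecord₅C F N (θ.toStage5₁₀ F N) P) → ∀ P : B12.RunParams, B11Leaf (θ.res.Z P))
    (slots₀₈ : ∀ (θ : Stage9Params F N) (hP : θ.Provisos₁₀), θ.Admissible → D = datumOfRecord₁₀ F N θ hP →
      (∀ P, w.up P = upOfRecord₅C F N (θ.toStage5₁₀ F N) P) → ∀ P : B12.RunParams,
        ∃ (Xc : PrintedCarriersR) (I : Type) (C : B10Assembly.Consts) (T : I → B10.TowerRun),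
          Nonempty (∀ i, B10Assembly.LeafSystem C (T i)) ∧ θ.res.X P = Xc.withTowerRuns10 T)
    (slot12 : ∀ (θ : Stage9Params F N) (hP : θ.Provisos₁₀), θ.Admissible → D = datumOfRecord₁₀ F N θ hP → w.γ ≤ θ.γ →
      (∀ P, w.up P = upOfRecord₅C F N (θ.toStage5₁₀ F N) P) → ∀ P : B12.RunParams, B12Sec2to5.Lemma4Printed (θ.res.X P).F12 (θ.res.X P).c12)
    (h11dom : ∀ (θ : Stage9Params F N) (hP : θ.Provisos₁₀), θ.Admissible → D = datumOfRecord₁₀ F N θ hP → w.γ ≤ θ.γ →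
      ∀ (p : B12.RunParams) (k : ℕ), k ≤ p.K →
        ∀ V ∈ domAltOfRecord F N θ.ν p.K k, UkExists F N p.K k θ.εbg V ∧ UniqueUkOrbit F N p.K k θ.εbg V)
    (hres : ∀ (θ : Stage9Params F N) (hP : θ.Provisos₁₀), θ.Admissible → D = datumOfRecord₁₀ F N θ hP → w.γ ≤ θ.γ →
      ∀ (p : B12.RunParams) (k : ℕ), k ≤ p.K → HRestrict F N θ.εbg p.K k (domAltOfRecord F N θ.ν p.K k))
    (huniq : ∀ (θ : Stage9Params F N) (hP : θ.Provisos₁₀), θ.Admissible → D = datumOfRecord₁₀ F N θ hP → w.γ ≤ θ.γ →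
      ∀ (p : B12.RunParams) (k : ℕ), k ≤ p.K → ∀ V ∈ domAltOfRecord F N θ.ν p.K k, ∀ j < k,
        UniqueUkOrbit F N p.K (j + 1) θ.εbg (Averaging.iter (avOfRecord F N p.K) (j + 1) (Uk F N p.K k θ.εbg V)))
    (slots₁₀ : ∀ (θ : Stage9Params F N) (hP : θ.Provisos₁₀), θ.Admissible → D = datumOfRecord₁₀ F N θ hP →
      (∀ P, w.up P = upOfRecord₅C F N (θ.toStage5₁₀ F N) P) → ∀ P : B12.RunParams,
        B9LeafX (θ.res.Y P) →
          (B10.Thm1PrintedCompact (θ.res.X P).runs10 ∧ B10.Thm2Printed (θ.res.X P).runs10) →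
            B11Leaf (θ.res.Z P) → B12Sec2to5.Lemma4Printed (θ.res.X P).F12 (θ.res.X P).c12 →
              B13.Lemma1Printed (θ.res.X P).S13 (θ.res.X P).c13 ∧ B13.Lemma2Printed (θ.res.X P).S13 (θ.res.X P).c13 ∧
                B13.Lemma3Printed (θ.res.X P).S13 (θ.res.X P).c13)
    (slots₁₁₁₃ : ∀ (θ : Stage9Params F N) (hP : θ.Provisos₁₀), θ.Admissible → D = datumOfRecord₁₀ F N θ hP →
      (∀ P, w.up P = upOfRecord₅C F N (θ.toStage5₁₀ F N) P) → ∀ P : B12.RunParams,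
        ((leavesP w P).smallCouplings → SLaw₁₀ F N θ P 0) ∧
        ((leavesP w P).b7 → (leavesP w P).b8 → (leavesP w P).b9 → (leavesP w P).b10 → (leavesP w P).b11 →
          (leavesP w P).smallCouplings → (leavesP w P).smallFieldInductive → (leavesP w P).flowControl →
            ∀ k, k < P.K → SLaw₁₀ F N θ P k → TLaw₁₀ F N θ P k) ∧
        (∀ k, k < P.K → TLaw₁₀ F N θ P k → SLaw₁₀ F N θ P (k + 1)) ∧
        ((genFlow (betaOfRecord₁₀ F N θ) P.g0).InInterval w.γ P.K → ∀ k, k ≤ P.K → SLaw₁₀ F N θ P k →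
          ∀ U : GaugeField (F.P P.K) k (SU N),
            chiFixed7 F N θ.ν P.K (gOfRecord₁₀ F N θ P) k U *
                  Real.exp (-(1 / (gOfRecord₁₀ F N θ P k) ^ 2 * wilsonBGOfRecord F N θ.εbg P k U)
                    - w.em (gOfRecord₁₀ F N θ P k) * (Fintype.card (Site (F.P P.K) k) : ℝ)) ≤ densOfRecord₁₀ F N θ P k U ∧
            densOfRecord₁₀ F N θ P k U ≤ Real.exp (w.ep (gOfRecord₁₀ F N θ P k) * (Fintype.card (Site (F.P P.K) k) : ℝ))))
    (slots₁₂ : ∀ (θ : Stage9Params F N) (hP : θ.Provisos₁₀), θ.Admissible → D = datumOfRecord₁₀ F N θ hP →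
      (∀ P, w.up P = upOfRecord₅C F N (θ.toStage5₁₀ F N) P) → ∀ P : B12.RunParams, B15Leaf (θ.res.W P))
    (hlo : FlowStep.BetaLowerH w.b γ₀ D.βfun) (hhi : FlowStep.BetaUpperH w.βup γ₀ D.βfun) :
    B16.EndStatementBPrinted D.C :=
  have hN := B16NodeKnitRecord10.nodes_N11_N13_of_isRecordOfRecord₁₀C h slots₁₁₁₃
  N24_at_record₁₀C h hγ₀ (N24_b8_main_of_isRecordOfRecord₁₀C_of_slot h slots₀₅) (N24_b9_main_of_isRecordOfRecord₁₀C_of_slot h slots₀₆)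
    (N24_b11_main_of_isRecordOfRecord₁₀C_of_slot h slots₀₇) (N24_b10_main_of_isRecordOfRecord₁₀C_of_slot h slots₀₈)
    (B12NodeKnitRecord10.b12_main_at_record₁₀C_of_leaf h slot12 h11dom hres huniq) (N24_b13_main_of_isRecordOfRecord₁₀C_of_slot h slots₁₀)
    (fun P => (hN P).1) (N24_b15_main_of_isRecordOfRecord₁₀C_of_slot h slots₁₂) (fun P => (hN P).2) hlo hhi

/-- **N24 · (B2) at the Stage-10 record with THE THREE STAGE-10-NATIVE CHILDREN BY NAME and the six carrier children as by-name binders** (for consumers already holding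
`∀ P, Dag.Bk_main (leavesP w P)` for N05 N06 N07 N08 N10 N12): N09 seat dag-n09-a's `b12_main_at_record₁₀C_of_leaf`, N11 ∧ N13 seat dag-n13-a's junction.
[cite: Balaban1989LargeFieldII, Thm 1 p.355, (0.1) pp.355–356, p.391; Balaban1988Convergent, Thm 1 p.262, Theorem p.245, p.244; Balaban1987RG1, Thm 3 p.264, Lemma 4 (3.53) p.280, (1.1)–(1.3) p.260 (bookkeeping over the Stage-10 record)] -/
theorem N24_at_record₁₀C_knit_N09_N11_N13 (h : IsRecordOfRecord₁₀C F N D w) {γ₀ : ℝ} (hγ₀ : w.γ ≤ γ₀)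
    (h05 : ∀ P : B12.RunParams, Dag.B8_main (leavesP w P)) (h06 : ∀ P : B12.RunParams, Dag.B9_main (leavesP w P))
    (h07 : ∀ P : B12.RunParams, Dag.B11_main (leavesP w P)) (h08 : ∀ P : B12.RunParams, Dag.B10_main (leavesP w P))
    (h10 : ∀ P : B12.RunParams, Dag.B13_main (leavesP w P)) (h12 : ∀ P : B12.RunParams, Dag.B15_main (leavesP w P))
    (slot12 : ∀ (θ : Stage9Params F N) (hP : θ.Provisos₁₀), θ.Admissible → D = datumOfRecord₁₀ F N θ hP → w.γ ≤ θ.γ →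
      (∀ P, w.up P = upOfRecord₅C F N (θ.toStage5₁₀ F N) P) → ∀ P : B12.RunParams, B12Sec2to5.Lemma4Printed (θ.res.X P).F12 (θ.res.X P).c12)
    (h11dom : ∀ (θ : Stage9Params F N) (hP : θ.Provisos₁₀), θ.Admissible → D = datumOfRecord₁₀ F N θ hP → w.γ ≤ θ.γ →
      ∀ (p : B12.RunParams) (k : ℕ), k ≤ p.K →
        ∀ V ∈ domAltOfRecord F N θ.ν p.K k, UkExists F N p.K k θ.εbg V ∧ UniqueUkOrbit F N p.K k θ.εbg V)
    (hres : ∀ (θ : Stage9Params F N) (hP : θ.Provisos₁₀), θ.Admissible → D = datumOfRecord₁₀ F N θ hP → w.γ ≤ θ.γ →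
      ∀ (p : B12.RunParams) (k : ℕ), k ≤ p.K → HRestrict F N θ.εbg p.K k (domAltOfRecord F N θ.ν p.K k))
    (huniq : ∀ (θ : Stage9Params F N) (hP : θ.Provisos₁₀), θ.Admissible → D = datumOfRecord₁₀ F N θ hP → w.γ ≤ θ.γ →
      ∀ (p : B12.RunParams) (k : ℕ), k ≤ p.K → ∀ V ∈ domAltOfRecord F N θ.ν p.K k, ∀ j < k,
        UniqueUkOrbit F N p.K (j + 1) θ.εbg (Averaging.iter (avOfRecord F N p.K) (j + 1) (Uk F N p.K k θ.εbg V)))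
    (slots₁₁₁₃ : ∀ (θ : Stage9Params F N) (hP : θ.Provisos₁₀), θ.Admissible → D = datumOfRecord₁₀ F N θ hP →
      (∀ P, w.up P = upOfRecord₅C F N (θ.toStage5₁₀ F N) P) → ∀ P : B12.RunParams,
        ((leavesP w P).smallCouplings → SLaw₁₀ F N θ P 0) ∧
        ((leavesP w P).b7 → (leavesP w P).b8 → (leavesP w P).b9 → (leavesP w P).b10 → (leavesP w P).b11 →
          (leavesP w P).smallCouplings → (leavesP w P).smallFieldInductive → (leavesP w P).flowControl →
            ∀ k, k < P.K → SLaw₁₀ F N θ P k → TLaw₁₀ F N θ P k) ∧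
        (∀ k, k < P.K → TLaw₁₀ F N θ P k → SLaw₁₀ F N θ P (k + 1)) ∧
        ((genFlow (betaOfRecord₁₀ F N θ) P.g0).InInterval w.γ P.K → ∀ k, k ≤ P.K → SLaw₁₀ F N θ P k →
          ∀ U : GaugeField (F.P P.K) k (SU N),
            chiFixed7 F N θ.ν P.K (gOfRecord₁₀ F N θ P) k U *
                  Real.exp (-(1 / (gOfRecord₁₀ F N θ P k) ^ 2 * wilsonBGOfRecord F N θ.εbg P k U)
                    - w.em (gOfRecord₁₀ F N θ P k) * (Fintype.card (Site (F.P P.K) k) : ℝ)) ≤ densOfRecord₁₀ F N θ P k U ∧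
            densOfRecord₁₀ F N θ P k U ≤ Real.exp (w.ep (gOfRecord₁₀ F N θ P k) * (Fintype.card (Site (F.P P.K) k) : ℝ))))
    (hlo : FlowStep.BetaLowerH w.b γ₀ D.βfun) (hhi : FlowStep.BetaUpperH w.βup γ₀ D.βfun) :
    B16.EndStatementBPrinted D.C :=
  have hN := B16NodeKnitRecord10.nodes_N11_N13_of_isRecordOfRecord₁₀C h slots₁₁₁₃
  N24_at_record₁₀C h hγ₀ h05 h06 h07 h08 (B12NodeKnitRecord10.b12_main_at_record₁₀C_of_leaf h slot12 h11dom hres huniq) h10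
    (fun P => (hN P).1) h12 (fun P => (hN P).2) hlo hhi

/-! ## §2. The β-binders READ AT THE MERGED β OVER THE CONTINUOUS-VERSION TRANSPORT (module 18 §2; RIDER №6 executed at Stage 10) -/

/-- **N24 · (B2) at the Stage-10 record, every child at θ₁₀ by name, with the β-binders READ AT THE MERGED β over `mergedTermFamilyMatT (TcOfRecord) (chiFixed7 θ.ν)`
along the world's own box `]0, w.γ]^{k+1}`** (module 18's `N24_betaLowerH_iff_merged₁₀` ∕ `N24_betaUpperH_iff_merged₁₀` at the record's presenting `θ`, through seat
node00-def-T's `βfun_datumOfRecord₁₀_eq_betaOfRecord₈T`).  WHICH CHILD BLOCKS at ₁₀C, kernel form: the hypothesis list — six residual-carrier sockets ∕ slots, N09's four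
Stage-10 inputs, the four N11∕N13 slots, and two bounds on the merged β over the continuous-version transport (lower `b > 0` UNPRINTED, T09.F = NODE O; upper β⁺
[Balaban1987RG1] p. 264) — NO pure node binder.  β-VERSION (RIDER №6 executed): point values determined under the record's `contT`
(`Record10.exists_betaVersion_of_isRecordOfRecord₁₀C`). [cite: Balaban1989LargeFieldII, Thm 1 p.355, (0.1) pp.355–356, p.387, p.391; Balaban1987RG1, (0.19) p.255, (1.20)–(1.22) p.264, (2.12)–(2.14) p.268, Thm 3 p.264, Lemma 4 (3.53) p.280; Balaban1988Convergent, Thm 1 p.262, Theorem p.245, p.244 (bookkeeping over the Stage-10 record)] -/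
theorem N24_at_record₁₀C_knit_all_of_betaMerged_pinned (h : IsRecordOfRecord₁₀C F N D w)
    (slots₀₅ : ∀ (θ : Stage9Params F N) (hP : θ.Provisos₁₀), θ.Admissible → D = datumOfRecord₁₀ F N θ hP →
      (∀ P, w.up P = upOfRecord₅C F N (θ.toStage5₁₀ F N) P) → ∀ P : B12.RunParams,
        B8LeafR (θ.res.X P).d8 (θ.res.X P).L8 (θ.res.X P).C₂ (θ.res.X P).B₁' (θ.res.X P).B₀' (θ.res.X P).B₁ (θ.res.X P).B₂ (θ.res.X P).c₁
          (θ.res.X P).inp8 (θ.res.X P).B₀β (θ.res.X P).loc8 (θ.res.X P).fam8R (θ.res.X P).lan8 (θ.res.X P).cub8 (θ.res.X P).toAxial8)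
    (slots₀₆ : ∀ (θ : Stage9Params F N) (hP : θ.Provisos₁₀), θ.Admissible → D = datumOfRecord₁₀ F N θ hP →
      (∀ P, w.up P = upOfRecord₅C F N (θ.toStage5₁₀ F N) P) → ∀ P : B12.RunParams, B9LeafX (θ.res.Y P))
    (slots₀₇ : ∀ (θ : Stage9Params F N) (hP : θ.Provisos₁₀), θ.Admissible → D = datumOfRecord₁₀ F N θ hP →
      (∀ P, w.up P = upOfRecord₅C F N (θ.toStage5₁₀ F N) P) → ∀ P : B12.RunParams, B11Leaf (θ.res.Z P))
    (slots₀₈ : ∀ (θ : Stage9Params F N) (hP : θ.Provisos₁₀), θ.Admissible → D = datumOfRecord₁₀ F N θ hP →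
      (∀ P, w.up P = upOfRecord₅C F N (θ.toStage5₁₀ F N) P) → ∀ P : B12.RunParams,
        ∃ (Xc : PrintedCarriersR) (I : Type) (C : B10Assembly.Consts) (T : I → B10.TowerRun),
          Nonempty (∀ i, B10Assembly.LeafSystem C (T i)) ∧ θ.res.X P = Xc.withTowerRuns10 T)
    (slot12 : ∀ (θ : Stage9Params F N) (hP : θ.Provisos₁₀), θ.Admissible → D = datumOfRecord₁₀ F N θ hP → w.γ ≤ θ.γ →
      (∀ P, w.up P = upOfRecord₅C F N (θ.toStage5₁₀ F N) P) → ∀ P : B12.RunParams, B12Sec2to5.Lemma4Printed (θ.res.X P).F12 (θ.res.X P).c12)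
    (h11dom : ∀ (θ : Stage9Params F N) (hP : θ.Provisos₁₀), θ.Admissible → D = datumOfRecord₁₀ F N θ hP → w.γ ≤ θ.γ →
      ∀ (p : B12.RunParams) (k : ℕ), k ≤ p.K →
        ∀ V ∈ domAltOfRecord F N θ.ν p.K k, UkExists F N p.K k θ.εbg V ∧ UniqueUkOrbit F N p.K k θ.εbg V)
    (hres : ∀ (θ : Stage9Params F N) (hP : θ.Provisos₁₀), θ.Admissible → D = datumOfRecord₁₀ F N θ hP → w.γ ≤ θ.γ →
      ∀ (p : B12.RunParams) (k : ℕ), k ≤ p.K → HRestrict F N θ.εbg p.K k (domAltOfRecord F N θ.ν p.K k))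
    (huniq : ∀ (θ : Stage9Params F N) (hP : θ.Provisos₁₀), θ.Admissible → D = datumOfRecord₁₀ F N θ hP → w.γ ≤ θ.γ →
      ∀ (p : B12.RunParams) (k : ℕ), k ≤ p.K → ∀ V ∈ domAltOfRecord F N θ.ν p.K k, ∀ j < k,
        UniqueUkOrbit F N p.K (j + 1) θ.εbg (Averaging.iter (avOfRecord F N p.K) (j + 1) (Uk F N p.K k θ.εbg V)))
    (slots₁₀ : ∀ (θ : Stage9Params F N) (hP : θ.Provisos₁₀), θ.Admissible → D = datumOfRecord₁₀ F N θ hP →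
      (∀ P, w.up P = upOfRecord₅C F N (θ.toStage5₁₀ F N) P) → ∀ P : B12.RunParams,
        B9LeafX (θ.res.Y P) →
          (B10.Thm1PrintedCompact (θ.res.X P).runs10 ∧ B10.Thm2Printed (θ.res.X P).runs10) →
            B11Leaf (θ.res.Z P) → B12Sec2to5.Lemma4Printed (θ.res.X P).F12 (θ.res.X P).c12 →
              B13.Lemma1Printed (θ.res.X P).S13 (θ.res.X P).c13 ∧ B13.Lemma2Printed (θ.res.X P).S13 (θ.res.X P).c13 ∧
                B13.Lemma3Printed (θ.res.X P).S13 (θ.res.X P).c13)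
    (slots₁₁₁₃ : ∀ (θ : Stage9Params F N) (hP : θ.Provisos₁₀), θ.Admissible → D = datumOfRecord₁₀ F N θ hP →
      (∀ P, w.up P = upOfRecord₅C F N (θ.toStage5₁₀ F N) P) → ∀ P : B12.RunParams,
        ((leavesP w P).smallCouplings → SLaw₁₀ F N θ P 0) ∧
        ((leavesP w P).b7 → (leavesP w P).b8 → (leavesP w P).b9 → (leavesP w P).b10 → (leavesP w P).b11 →
          (leavesP w P).smallCouplings → (leavesP w P).smallFieldInductive → (leavesP w P).flowControl →
            ∀ k, k < P.K → SLaw₁₀ F N θ P k → TLaw₁₀ F N θ P k) ∧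
        (∀ k, k < P.K → TLaw₁₀ F N θ P k → SLaw₁₀ F N θ P (k + 1)) ∧
        ((genFlow (betaOfRecord₁₀ F N θ) P.g0).InInterval w.γ P.K → ∀ k, k ≤ P.K → SLaw₁₀ F N θ P k →
          ∀ U : GaugeField (F.P P.K) k (SU N),
            chiFixed7 F N θ.ν P.K (gOfRecord₁₀ F N θ P) k U *
                  Real.exp (-(1 / (gOfRecord₁₀ F N θ P k) ^ 2 * wilsonBGOfRecord F N θ.εbg P k U)
                    - w.em (gOfRecord₁₀ F N θ P k) * (Fintype.card (Site (F.P P.K) k) : ℝ)) ≤ densOfRecord₁₀ F N θ P k U ∧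
            densOfRecord₁₀ F N θ P k U ≤ Real.exp (w.ep (gOfRecord₁₀ F N θ P k) * (Fintype.card (Site (F.P P.K) k) : ℝ))))
    (slots₁₂ : ∀ (θ : Stage9Params F N) (hP : θ.Provisos₁₀), θ.Admissible → D = datumOfRecord₁₀ F N θ hP →
      (∀ P, w.up P = upOfRecord₅C F N (θ.toStage5₁₀ F N) P) → ∀ P : B12.RunParams, B15Leaf (θ.res.W P))
    (hβm : ∀ (θ : Stage9Params F N) (hP : θ.Provisos₁₀), θ.Admissible → D = datumOfRecord₁₀ F N θ hP → w.γ ≤ θ.γ →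
      letI := θ.instVβ₁; letI := θ.instVβ₂; letI := θ.instιβ
      FlowStep.BetaLowerH w.b w.γ (betaMerged F (mergedTermFamilyMatT F N (TcOfRecord F N) (chiFixed7 F N θ.ν) θ.εbg) θ.ρ8 θ.bV) ∧
        FlowStep.BetaUpperH w.βup w.γ (betaMerged F (mergedTermFamilyMatT F N (TcOfRecord F N) (chiFixed7 F N θ.ν) θ.εbg) θ.ρ8 θ.bV)) :
    B16.EndStatementBPrinted D.C := by
  obtain ⟨θ, hP, hθ, hD, -, hγ, -, -⟩ := id h
  obtain ⟨hlo, hhi⟩ := hβm θ hP hθ hD hγ.2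
  exact N24_at_record₁₀C_knit_all_pinned h le_rfl slots₀₅ slots₀₆ slots₀₇ slots₀₈ slot12 h11dom hres huniq slots₁₀ slots₁₁₁₃ slots₁₂
    ((N24_betaLowerH_iff_merged₁₀ θ hP hD hγ.2).mpr hlo) ((N24_betaUpperH_iff_merged₁₀ θ hP hD hγ.2).mpr hhi)

/-! ## §3. The item body in its literal shape at a Stage-10 record, every child by name -/

/-- **The item body (stmt-QuantumFields-19183 `StabilityBAtRecord`, rev 0) in its LITERAL SHAPE at general `N`, at a STAGE-10 record, every child at θ₁₀ by name**:
`IsDatumOfRecord₀ F N D ∧ B16.EndStatementBPrinted D.C ∧ ∃ γ₁ > 0, ∀ γ ∈ ]0, γ₁], ∃ P, (D.C P).flow.InInterval γ P.K` — Stage 0 from the record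
(`isDatumOfRecord₀_of_isRecordOfRecord₁₀C`), (B2) by §1, `γ₁ := γ₀` and the run `⟨K, m, g₀⟩` of module 8's K-indexed window (`N24_window_allK_of_betaUpperH`, from `hhi` alone).
[cite: Balaban1989LargeFieldII, Thm 1 p.355 + p.391; Balaban1987RG1, (0.4) p.253, (0.18)–(0.20) pp.255–256 and p.264 (bookkeeping + elementary window)] -/
theorem N24_stabilityB_itemShape₁₀C_knit_all_pinned (h : IsRecordOfRecord₁₀C F N D w) {γ₀ : ℝ} (hγ₀ : w.γ ≤ γ₀) (K m : ℕ)
    (slots₀₅ : ∀ (θ : Stage9Params F N) (hP : θ.Provisos₁₀), θ.Admissible → D = datumOfRecord₁₀ F N θ hP →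
      (∀ P, w.up P = upOfRecord₅C F N (θ.toStage5₁₀ F N) P) → ∀ P : B12.RunParams,
        B8LeafR (θ.res.X P).d8 (θ.res.X P).L8 (θ.res.X P).C₂ (θ.res.X P).B₁' (θ.res.X P).B₀' (θ.res.X P).B₁ (θ.res.X P).B₂ (θ.res.X P).c₁
          (θ.res.X P).inp8 (θ.res.X P).B₀β (θ.res.X P).loc8 (θ.res.X P).fam8R (θ.res.X P).lan8 (θ.res.X P).cub8 (θ.res.X P).toAxial8)
    (slots₀₆ : ∀ (θ : Stage9Params F N) (hP : θ.Provisos₁₀), θ.Admissible → D = datumOfRecord₁₀ F N θ hP →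
      (∀ P, w.up P = upOfRecord₅C F N (θ.toStage5₁₀ F N) P) → ∀ P : B12.RunParams, B9LeafX (θ.res.Y P))
    (slots₀₇ : ∀ (θ : Stage9Params F N) (hP : θ.Provisos₁₀), θ.Admissible → D = datumOfRecord₁₀ F N θ hP →
      (∀ P, w.up P = upOfRecord₅C F N (θ.toStage5₁₀ F N) P) → ∀ P : B12.RunParams, B11Leaf (θ.res.Z P))
    (slots₀₈ : ∀ (θ : Stage9Params F N) (hP : θ.Provisos₁₀), θ.Admissible → D = datumOfRecord₁₀ F N θ hP →
      (∀ P, w.up P = upOfRecord₅C F N (θ.toStage5₁₀ F N) P) → ∀ P : B12.RunParams,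
        ∃ (Xc : PrintedCarriersR) (I : Type) (C : B10Assembly.Consts) (T : I → B10.TowerRun),
          Nonempty (∀ i, B10Assembly.LeafSystem C (T i)) ∧ θ.res.X P = Xc.withTowerRuns10 T)
    (slot12 : ∀ (θ : Stage9Params F N) (hP : θ.Provisos₁₀), θ.Admissible → D = datumOfRecord₁₀ F N θ hP → w.γ ≤ θ.γ →
      (∀ P, w.up P = upOfRecord₅C F N (θ.toStage5₁₀ F N) P) → ∀ P : B12.RunParams, B12Sec2to5.Lemma4Printed (θ.res.X P).F12 (θ.res.X P).c12)
    (h11dom : ∀ (θ : Stage9Params F N) (hP : θ.Provisos₁₀), θ.Admissible → D = datumOfRecord₁₀ F N θ hP → w.γ ≤ θ.γ →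
      ∀ (p : B12.RunParams) (k : ℕ), k ≤ p.K →
        ∀ V ∈ domAltOfRecord F N θ.ν p.K k, UkExists F N p.K k θ.εbg V ∧ UniqueUkOrbit F N p.K k θ.εbg V)
    (hres : ∀ (θ : Stage9Params F N) (hP : θ.Provisos₁₀), θ.Admissible → D = datumOfRecord₁₀ F N θ hP → w.γ ≤ θ.γ →
      ∀ (p : B12.RunParams) (k : ℕ), k ≤ p.K → HRestrict F N θ.εbg p.K k (domAltOfRecord F N θ.ν p.K k))
    (huniq : ∀ (θ : Stage9Params F N) (hP : θ.Provisos₁₀), θ.Admissible → D = datumOfRecord₁₀ F N θ hP → w.γ ≤ θ.γ →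
      ∀ (p : B12.RunParams) (k : ℕ), k ≤ p.K → ∀ V ∈ domAltOfRecord F N θ.ν p.K k, ∀ j < k,
        UniqueUkOrbit F N p.K (j + 1) θ.εbg (Averaging.iter (avOfRecord F N p.K) (j + 1) (Uk F N p.K k θ.εbg V)))
    (slots₁₀ : ∀ (θ : Stage9Params F N) (hP : θ.Provisos₁₀), θ.Admissible → D = datumOfRecord₁₀ F N θ hP →
      (∀ P, w.up P = upOfRecord₅C F N (θ.toStage5₁₀ F N) P) → ∀ P : B12.RunParams,
        B9LeafX (θ.res.Y P) →
          (B10.Thm1PrintedCompact (θ.res.X P).runs10 ∧ B10.Thm2Printed (θ.res.X P).runs10) →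
            B11Leaf (θ.res.Z P) → B12Sec2to5.Lemma4Printed (θ.res.X P).F12 (θ.res.X P).c12 →
              B13.Lemma1Printed (θ.res.X P).S13 (θ.res.X P).c13 ∧ B13.Lemma2Printed (θ.res.X P).S13 (θ.res.X P).c13 ∧
                B13.Lemma3Printed (θ.res.X P).S13 (θ.res.X P).c13)
    (slots₁₁₁₃ : ∀ (θ : Stage9Params F N) (hP : θ.Provisos₁₀), θ.Admissible → D = datumOfRecord₁₀ F N θ hP →
      (∀ P, w.up P = upOfRecord₅C F N (θ.toStage5₁₀ F N) P) → ∀ P : B12.RunParams,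
        ((leavesP w P).smallCouplings → SLaw₁₀ F N θ P 0) ∧
        ((leavesP w P).b7 → (leavesP w P).b8 → (leavesP w P).b9 → (leavesP w P).b10 → (leavesP w P).b11 →
          (leavesP w P).smallCouplings → (leavesP w P).smallFieldInductive → (leavesP w P).flowControl →
            ∀ k, k < P.K → SLaw₁₀ F N θ P k → TLaw₁₀ F N θ P k) ∧
        (∀ k, k < P.K → TLaw₁₀ F N θ P k → SLaw₁₀ F N θ P (k + 1)) ∧
        ((genFlow (betaOfRecord₁₀ F N θ) P.g0).InInterval w.γ P.K → ∀ k, k ≤ P.K → SLaw₁₀ F N θ P k →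
          ∀ U : GaugeField (F.P P.K) k (SU N),
            chiFixed7 F N θ.ν P.K (gOfRecord₁₀ F N θ P) k U *
                  Real.exp (-(1 / (gOfRecord₁₀ F N θ P k) ^ 2 * wilsonBGOfRecord F N θ.εbg P k U)
                    - w.em (gOfRecord₁₀ F N θ P k) * (Fintype.card (Site (F.P P.K) k) : ℝ)) ≤ densOfRecord₁₀ F N θ P k U ∧
            densOfRecord₁₀ F N θ P k U ≤ Real.exp (w.ep (gOfRecord₁₀ F N θ P k) * (Fintype.card (Site (F.P P.K) k) : ℝ))))
    (slots₁₂ : ∀ (θ : Stage9Params F N) (hP : θ.Provisos₁₀), θ.Admissible → D = datumOfRecord₁₀ F N θ hP →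
      (∀ P, w.up P = upOfRecord₅C F N (θ.toStage5₁₀ F N) P) → ∀ P : B12.RunParams, B15Leaf (θ.res.W P))
    (hlo : FlowStep.BetaLowerH w.b γ₀ D.βfun) (hhi : FlowStep.BetaUpperH w.βup γ₀ D.βfun) :
    IsDatumOfRecord₀ F N D ∧ B16.EndStatementBPrinted D.C ∧
      ∃ γ₁ : ℝ, 0 < γ₁ ∧ ∀ γ : ℝ, 0 < γ → γ ≤ γ₁ → ∃ P : B12.RunParams, (D.C P).flow.InInterval γ P.K := by
  refine ⟨isDatumOfRecord₀_of_isRecordOfRecord₁₀C h,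
    N24_at_record₁₀C_knit_all_pinned h hγ₀ slots₀₅ slots₀₆ slots₀₇ slots₀₈ slot12 h11dom hres huniq slots₁₀ slots₁₁₁₃ slots₁₂ hlo hhi,
    γ₀, (gamma_pos_of_isRecordOfRecord₁₀C h).trans_le hγ₀, fun γ hγ hγle => ?_⟩
  obtain ⟨g0, -, hrun⟩ := N24_window_allK_of_betaUpperH D hhi hγ hγle m K
  exact ⟨⟨K, m, g0⟩, hrun⟩

/-! ## §4. At the top of the Stage-10 carrier chain `IsRecordOfRecord₁₀CB10YZ` (node00-def g30's `Record10Carriers`; same datum, same world) -/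

/-- **The one-line transfer**: every child at θ₁₀ by name (§1) at a record of the cumulative carrier-pinned Stage-10 predicate `IsRecordOfRecord₁₀CB10YZ`, through
`isRecordOfRecord₁₀C_of_isRecordOfRecord₁₀CB10YZ` (same `(D, w)`; the θ-keyed sockets quantify over every ₁₀C-presentation, the pinned ones included —
`Stage9Params.toStage5₁₀_pinB10 ∕ _pinY ∕ _pinZ`). [cite: Balaban1989LargeFieldII, Thm 1 p.355 + pp.387, 391; Balaban1985UV3, Thm 1 p.257 + Thm 2 p.272; Balaban1985BackgroundPropagators, Thms 3.1–3.15 pp.397–432; Balaban1985Variational, Thm 1 p.279 (bookkeeping over the carrier-pinned Stage-10 record)] -/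
theorem N24_at_record₁₀CB10YZ_knit_all_pinned (h : IsRecordOfRecord₁₀CB10YZ F N D w) {γ₀ : ℝ} (hγ₀ : w.γ ≤ γ₀)
    (slots₀₅ : ∀ (θ : Stage9Params F N) (hP : θ.Provisos₁₀), θ.Admissible → D = datumOfRecord₁₀ F N θ hP →
      (∀ P, w.up P = upOfRecord₅C F N (θ.toStage5₁₀ F N) P) → ∀ P : B12.RunParams,
        B8LeafR (θ.res.X P).d8 (θ.res.X P).L8 (θ.res.X P).C₂ (θ.res.X P).B₁' (θ.res.X P).B₀' (θ.res.X P).B₁ (θ.res.X P).B₂ (θ.res.X P).c₁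
          (θ.res.X P).inp8 (θ.res.X P).B₀β (θ.res.X P).loc8 (θ.res.X P).fam8R (θ.res.X P).lan8 (θ.res.X P).cub8 (θ.res.X P).toAxial8)
    (slots₀₆ : ∀ (θ : Stage9Params F N) (hP : θ.Provisos₁₀), θ.Admissible → D = datumOfRecord₁₀ F N θ hP →
      (∀ P, w.up P = upOfRecord₅C F N (θ.toStage5₁₀ F N) P) → ∀ P : B12.RunParams, B9LeafX (θ.res.Y P))
    (slots₀₇ : ∀ (θ : Stage9Params F N) (hP : θ.Provisos₁₀), θ.Admissible → D = datumOfRecord₁₀ F N θ hP →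
      (∀ P, w.up P = upOfRecord₅C F N (θ.toStage5₁₀ F N) P) → ∀ P : B12.RunParams, B11Leaf (θ.res.Z P))
    (slots₀₈ : ∀ (θ : Stage9Params F N) (hP : θ.Provisos₁₀), θ.Admissible → D = datumOfRecord₁₀ F N θ hP →
      (∀ P, w.up P = upOfRecord₅C F N (θ.toStage5₁₀ F N) P) → ∀ P : B12.RunParams,
        ∃ (Xc : PrintedCarriersR) (I : Type) (C : B10Assembly.Consts) (T : I → B10.TowerRun),
          Nonempty (∀ i, B10Assembly.LeafSystem C (T i)) ∧ θ.res.X P = Xc.withTowerRuns10 T)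
    (slot12 : ∀ (θ : Stage9Params F N) (hP : θ.Provisos₁₀), θ.Admissible → D = datumOfRecord₁₀ F N θ hP → w.γ ≤ θ.γ →
      (∀ P, w.up P = upOfRecord₅C F N (θ.toStage5₁₀ F N) P) → ∀ P : B12.RunParams, B12Sec2to5.Lemma4Printed (θ.res.X P).F12 (θ.res.X P).c12)
    (h11dom : ∀ (θ : Stage9Params F N) (hP : θ.Provisos₁₀), θ.Admissible → D = datumOfRecord₁₀ F N θ hP → w.γ ≤ θ.γ →
      ∀ (p : B12.RunParams) (k : ℕ), k ≤ p.K →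
        ∀ V ∈ domAltOfRecord F N θ.ν p.K k, UkExists F N p.K k θ.εbg V ∧ UniqueUkOrbit F N p.K k θ.εbg V)
    (hres : ∀ (θ : Stage9Params F N) (hP : θ.Provisos₁₀), θ.Admissible → D = datumOfRecord₁₀ F N θ hP → w.γ ≤ θ.γ →
      ∀ (p : B12.RunParams) (k : ℕ), k ≤ p.K → HRestrict F N θ.εbg p.K k (domAltOfRecord F N θ.ν p.K k))
    (huniq : ∀ (θ : Stage9Params F N) (hP : θ.Provisos₁₀), θ.Admissible → D = datumOfRecord₁₀ F N θ hP → w.γ ≤ θ.γ →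
      ∀ (p : B12.RunParams) (k : ℕ), k ≤ p.K → ∀ V ∈ domAltOfRecord F N θ.ν p.K k, ∀ j < k,
        UniqueUkOrbit F N p.K (j + 1) θ.εbg (Averaging.iter (avOfRecord F N p.K) (j + 1) (Uk F N p.K k θ.εbg V)))
    (slots₁₀ : ∀ (θ : Stage9Params F N) (hP : θ.Provisos₁₀), θ.Admissible → D = datumOfRecord₁₀ F N θ hP →
      (∀ P, w.up P = upOfRecord₅C F N (θ.toStage5₁₀ F N) P) → ∀ P : B12.RunParams,
        B9LeafX (θ.res.Y P) →
          (B10.Thm1PrintedCompact (θ.res.X P).runs10 ∧ B10.Thm2Printed (θ.res.X P).runs10) →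
            B11Leaf (θ.res.Z P) → B12Sec2to5.Lemma4Printed (θ.res.X P).F12 (θ.res.X P).c12 →
              B13.Lemma1Printed (θ.res.X P).S13 (θ.res.X P).c13 ∧ B13.Lemma2Printed (θ.res.X P).S13 (θ.res.X P).c13 ∧
                B13.Lemma3Printed (θ.res.X P).S13 (θ.res.X P).c13)
    (slots₁₁₁₃ : ∀ (θ : Stage9Params F N) (hP : θ.Provisos₁₀), θ.Admissible → D = datumOfRecord₁₀ F N θ hP →
      (∀ P, w.up P = upOfRecord₅C F N (θ.toStage5₁₀ F N) P) → ∀ P : B12.RunParams,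
        ((leavesP w P).smallCouplings → SLaw₁₀ F N θ P 0) ∧
        ((leavesP w P).b7 → (leavesP w P).b8 → (leavesP w P).b9 → (leavesP w P).b10 → (leavesP w P).b11 →
          (leavesP w P).smallCouplings → (leavesP w P).smallFieldInductive → (leavesP w P).flowControl →
            ∀ k, k < P.K → SLaw₁₀ F N θ P k → TLaw₁₀ F N θ P k) ∧
        (∀ k, k < P.K → TLaw₁₀ F N θ P k → SLaw₁₀ F N θ P (k + 1)) ∧
        ((genFlow (betaOfRecord₁₀ F N θ) P.g0).InInterval w.γ P.K → ∀ k, k ≤ P.K → SLaw₁₀ F N θ P k →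
          ∀ U : GaugeField (F.P P.K) k (SU N),
            chiFixed7 F N θ.ν P.K (gOfRecord₁₀ F N θ P) k U *
                  Real.exp (-(1 / (gOfRecord₁₀ F N θ P k) ^ 2 * wilsonBGOfRecord F N θ.εbg P k U)
                    - w.em (gOfRecord₁₀ F N θ P k) * (Fintype.card (Site (F.P P.K) k) : ℝ)) ≤ densOfRecord₁₀ F N θ P k U ∧
            densOfRecord₁₀ F N θ P k U ≤ Real.exp (w.ep (gOfRecord₁₀ F N θ P k) * (Fintype.card (Site (F.P P.K) k) : ℝ))))
    (slots₁₂ : ∀ (θ : Stage9Params F N) (hP : θ.Provisos₁₀), θ.Admissible → D = datumOfRecord₁₀ F N θ hP →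
      (∀ P, w.up P = upOfRecord₅C F N (θ.toStage5₁₀ F N) P) → ∀ P : B12.RunParams, B15Leaf (θ.res.W P))
    (hlo : FlowStep.BetaLowerH w.b γ₀ D.βfun) (hhi : FlowStep.BetaUpperH w.βup γ₀ D.βfun) :
    B16.EndStatementBPrinted D.C :=
  N24_at_record₁₀C_knit_all_pinned (isRecordOfRecord₁₀C_of_isRecordOfRecord₁₀CB10YZ h) hγ₀ slots₀₅ slots₀₆ slots₀₇ slots₀₈ slot12 h11dom hres huniq
    slots₁₀ slots₁₁₁₃ slots₁₂ hlo hhi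

/-- **N08 · [Balaban1985UV3] at every run of a `₁₀CB10YZ` record FROM THE PRINTED SLOT AT THE WORLD'S BLOCK SIZE** (g30's `b10_main_iff_of_isRecordOfRecord₁₀CB10YZ`; module 17's
`N24_b10_main_of_isRecordOfRecord₉CB10Y_of_printedUV3V` at Stage 10). [cite: Balaban1985UV3, (1)–(5) p.256, Thm 1 p.257 (compact reading) + Thm 2 p.272] -/
theorem N24_b10_main_of_isRecordOfRecord₁₀CB10YZ_of_printedUV3V (h : IsRecordOfRecord₁₀CB10YZ F N D w)
    (hUV₀₈ : ∀ L : ℕ, Odd L → 1 < L → w.L = (L : ℝ) → PrintedUV3V N L) (P : B12.RunParams) : Dag.B10_main (leavesP w P) := by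
  obtain ⟨L, hL, hwL, hiff⟩ := b10_main_iff_of_isRecordOfRecord₁₀CB10YZ h
  exact (hiff P).2 fun _ _ _ _ _ _ => hUV₀₈ L hL.1 hL.2 hwL

/-- **N24 · (B2) AT THE TOP OF THE STAGE-10 CARRIER CHAIN, THE THREE PINNED CHILDREN AT THEIR STATEMENTS OF RECORD, EVERY OTHER CHILD AT θ₁₀ BY NAME** (module 17's
recipe at Stage 10 over g30's `Record10Carriers`): **N08** ← the printed slot `PrintedUV3V N L` at the world's odd block size `L > 1`; **N06 ∧ N07** ← «for every
`(θ, h, M⋆, ops, ζ)` presenting the record: def-Y's leaf `B9LeafX (Y9OfRecord N θ.toStage3Params M⋆ ops)` ∧ the [B11] leaf `B11Leaf (Z11OfRecord F N ζ)`»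
(`b9_b11_main_of_isRecordOfRecord₁₀CB10YZ_of_slots`; HONEST: both quantify over HIDDEN residual layers and are junk-closable — def-Y's `B9PinCarriersNonVacuity.exists_ops_b9LeafX`,
g30's `CarriersZ.exists_residZ_not_b11Leaf` shows the [B11] leaf is not automatic either — so neither child is bookable in ∀-form here; the re-key is LOCATION-positive,
STRENGTH-neutral); N05 N10 N12 θ-keyed sockets on X-[B8] ∕ B13 ∕ W (module 18 §0); **N09** n09-a's four Stage-10 inputs; **N11 ∧ N13** n13-a's junction; β-box on `D.βfun`.
WHICH CHILD BLOCKS at `₁₀CB10YZ`, kernel form: N08 one printed ∃-slot; N06 ∧ N07 the hidden layers' leaves; three residual sockets; N09 ×4; N11∧N13 ×4; β ×2; K0 at ₁₀.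
[cite: Balaban1989LargeFieldII, Thm 1 p.355, (0.1) pp.355–356, p.387, p.391; Balaban1985UV3, (1)–(5) p.256, Thm 1 p.257 + Thm 2 p.272; Balaban1985BackgroundPropagators, Thms 3.1–3.15 pp.397–432; Balaban1985Variational, Thm 1 p.279, Props 2–9 pp.281–309; Balaban1988Convergent, Thm 1 p.262, Theorem p.245, p.244; Balaban1987RG1, Thm 3 p.264, Lemma 4 (3.53) p.280, (1.1)–(1.3) p.260; Balaban1985RegularSpaces, Thms 2, 4, 8 pp.83–101; Balaban1988RG2Cluster, Lemmas 1–3 pp.9, 11, 20; Balaban1989LargeFieldI, Prop. 1 p.194 (bookkeeping over the carrier-pinned Stage-10 record)] -/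
theorem N24_at_record₁₀CB10YZ_knit_all_carriers_pinned (h : IsRecordOfRecord₁₀CB10YZ F N D w) {γ₀ : ℝ} (hγ₀ : w.γ ≤ γ₀)
    (slots₀₅ : ∀ (θ : Stage9Params F N) (hP : θ.Provisos₁₀), θ.Admissible → D = datumOfRecord₁₀ F N θ hP →
      (∀ P, w.up P = upOfRecord₅C F N (θ.toStage5₁₀ F N) P) → ∀ P : B12.RunParams,
        B8LeafR (θ.res.X P).d8 (θ.res.X P).L8 (θ.res.X P).C₂ (θ.res.X P).B₁' (θ.res.X P).B₀' (θ.res.X P).B₁ (θ.res.X P).B₂ (θ.res.X P).c₁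
          (θ.res.X P).inp8 (θ.res.X P).B₀β (θ.res.X P).loc8 (θ.res.X P).fam8R (θ.res.X P).lan8 (θ.res.X P).cub8 (θ.res.X P).toAxial8)
    (hYZ : ∀ (θ : Stage9Params F N) (hP : θ.Provisos₁₀) (Mstar : ℕ) (ops : OpsY N θ.toStage3Params Mstar) (ζ : ResidZ F N), θ.Admissible →
      D = datumOfRecord₁₀ F N θ hP → (∀ P, w.up P = upOfRecord₅C F N (θ.view₁₀B10YZ F N Mstar ops ζ) P) →
        B9LeafX (Y9OfRecord N θ.toStage3Params Mstar ops) ∧ B11Leaf (Z11OfRecord F N ζ))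
    (hUV₀₈ : ∀ L : ℕ, Odd L → 1 < L → w.L = (L : ℝ) → PrintedUV3V N L)
    (slot12 : ∀ (θ : Stage9Params F N) (hP : θ.Provisos₁₀), θ.Admissible → D = datumOfRecord₁₀ F N θ hP → w.γ ≤ θ.γ →
      (∀ P, w.up P = upOfRecord₅C F N (θ.toStage5₁₀ F N) P) → ∀ P : B12.RunParams, B12Sec2to5.Lemma4Printed (θ.res.X P).F12 (θ.res.X P).c12)
    (h11dom : ∀ (θ : Stage9Params F N) (hP : θ.Provisos₁₀), θ.Admissible → D = datumOfRecord₁₀ F N θ hP → w.γ ≤ θ.γ →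
      ∀ (p : B12.RunParams) (k : ℕ), k ≤ p.K →
        ∀ V ∈ domAltOfRecord F N θ.ν p.K k, UkExists F N p.K k θ.εbg V ∧ UniqueUkOrbit F N p.K k θ.εbg V)
    (hres : ∀ (θ : Stage9Params F N) (hP : θ.Provisos₁₀), θ.Admissible → D = datumOfRecord₁₀ F N θ hP → w.γ ≤ θ.γ →
      ∀ (p : B12.RunParams) (k : ℕ), k ≤ p.K → HRestrict F N θ.εbg p.K k (domAltOfRecord F N θ.ν p.K k))
    (huniq : ∀ (θ : Stage9Params F N) (hP : θ.Provisos₁₀), θ.Admissible → D = datumOfRecord₁₀ F N θ hP → w.γ ≤ θ.γ →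
      ∀ (p : B12.RunParams) (k : ℕ), k ≤ p.K → ∀ V ∈ domAltOfRecord F N θ.ν p.K k, ∀ j < k,
        UniqueUkOrbit F N p.K (j + 1) θ.εbg (Averaging.iter (avOfRecord F N p.K) (j + 1) (Uk F N p.K k θ.εbg V)))
    (slots₁₀ : ∀ (θ : Stage9Params F N) (hP : θ.Provisos₁₀), θ.Admissible → D = datumOfRecord₁₀ F N θ hP →
      (∀ P, w.up P = upOfRecord₅C F N (θ.toStage5₁₀ F N) P) → ∀ P : B12.RunParams,
        B9LeafX (θ.res.Y P) →
          (B10.Thm1PrintedCompact (θ.res.X P).runs10 ∧ B10.Thm2Printed (θ.res.X P).runs10) →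
            B11Leaf (θ.res.Z P) → B12Sec2to5.Lemma4Printed (θ.res.X P).F12 (θ.res.X P).c12 →
              B13.Lemma1Printed (θ.res.X P).S13 (θ.res.X P).c13 ∧ B13.Lemma2Printed (θ.res.X P).S13 (θ.res.X P).c13 ∧
                B13.Lemma3Printed (θ.res.X P).S13 (θ.res.X P).c13)
    (slots₁₁₁₃ : ∀ (θ : Stage9Params F N) (hP : θ.Provisos₁₀), θ.Admissible → D = datumOfRecord₁₀ F N θ hP →
      (∀ P, w.up P = upOfRecord₅C F N (θ.toStage5₁₀ F N) P) → ∀ P : B12.RunParams,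
        ((leavesP w P).smallCouplings → SLaw₁₀ F N θ P 0) ∧
        ((leavesP w P).b7 → (leavesP w P).b8 → (leavesP w P).b9 → (leavesP w P).b10 → (leavesP w P).b11 →
          (leavesP w P).smallCouplings → (leavesP w P).smallFieldInductive → (leavesP w P).flowControl →
            ∀ k, k < P.K → SLaw₁₀ F N θ P k → TLaw₁₀ F N θ P k) ∧
        (∀ k, k < P.K → TLaw₁₀ F N θ P k → SLaw₁₀ F N θ P (k + 1)) ∧
        ((genFlow (betaOfRecord₁₀ F N θ) P.g0).InInterval w.γ P.K → ∀ k, k ≤ P.K → SLaw₁₀ F N θ P k →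
          ∀ U : GaugeField (F.P P.K) k (SU N),
            chiFixed7 F N θ.ν P.K (gOfRecord₁₀ F N θ P) k U *
                  Real.exp (-(1 / (gOfRecord₁₀ F N θ P k) ^ 2 * wilsonBGOfRecord F N θ.εbg P k U)
                    - w.em (gOfRecord₁₀ F N θ P k) * (Fintype.card (Site (F.P P.K) k) : ℝ)) ≤ densOfRecord₁₀ F N θ P k U ∧
            densOfRecord₁₀ F N θ P k U ≤ Real.exp (w.ep (gOfRecord₁₀ F N θ P k) * (Fintype.card (Site (F.P P.K) k) : ℝ))))
    (slots₁₂ : ∀ (θ : Stage9Params F N) (hP : θ.Provisos₁₀), θ.Admissible → D = datumOfRecord₁₀ F N θ hP →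
      (∀ P, w.up P = upOfRecord₅C F N (θ.toStage5₁₀ F N) P) → ∀ P : B12.RunParams, B15Leaf (θ.res.W P))
    (hlo : FlowStep.BetaLowerH w.b γ₀ D.βfun) (hhi : FlowStep.BetaUpperH w.βup γ₀ D.βfun) :
    B16.EndStatementBPrinted D.C :=
  have h₁₀ := isRecordOfRecord₁₀C_of_isRecordOfRecord₁₀CB10YZ h
  have hN := B16NodeKnitRecord10.nodes_N11_N13_of_isRecordOfRecord₁₀C h₁₀ slots₁₁₁₃
  have h67 := b9_b11_main_of_isRecordOfRecord₁₀CB10YZ_of_slots h hYZ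
  N24_at_record₁₀C h₁₀ hγ₀ (N24_b8_main_of_isRecordOfRecord₁₀C_of_slot h₁₀ slots₀₅) (fun P => (h67 P).1) (fun P => (h67 P).2)
    (N24_b10_main_of_isRecordOfRecord₁₀CB10YZ_of_printedUV3V h hUV₀₈)
    (B12NodeKnitRecord10.b12_main_at_record₁₀C_of_leaf h₁₀ slot12 h11dom hres huniq) (N24_b13_main_of_isRecordOfRecord₁₀C_of_slot h₁₀ slots₁₀)
    (fun P => (hN P).1) (N24_b15_main_of_isRecordOfRecord₁₀C_of_slot h₁₀ slots₁₂) (fun P => (hN P).2) hlo hhi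

end Literature.MathematicalPhysics.QuantumFieldTheory.Balaban1983to89.Node00

end
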